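import Summits.QuantumFields.YangMills.Theses.EquipartitionCriticality

/-!
# `EquipartitionCriticality.LogConvexContraction` (stmt-QuantumFields-8764)

The support item `LogConvexContraction` of route `EquipartitionCriticality`: a non-negative
log-convex sequence `a` (`a (n+1)² ≤ a n · a (n+2)`) dominated by `C · e^(−m n)` with `m > 0`
contracts stepwise, `a (n+1) ≤ e^(−m) · a n` for every `n`.

Proof (elementary, [folklore]; the sequence lemma behind "a uniform gap bounds the effective mass
at every separation", cf. Glimm–Jaffe 1987 §6, Seiler LNP 159): suppose `a (n+1) > e^(−m) a n`.
Then `a (n+1) > 0`, hence `a n > 0` by log-convexity, and the ratio `r = a (n+1) / a n > e^(−m)`.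
Log-convexity propagates positivity and makes the ratios non-decreasing, so `a (n+k) ≥ r^k a n`,
while the domination gives `a (n+k) ≤ C e^(−m n) e^(−m k)`; hence `(r e^m)^k ≤ C e^(−m n) / a n`
for all `k`, impossible since `r e^m > 1`.
-/

namespace Summit.QuantumFields.YangMills.Theorems

open Summit.QuantumFields.YangMills.Theses.EquipartitionCriticality

/-- **`EquipartitionCriticality.LogConvexContraction` holds** (item stmt-QuantumFields-8764):
for every `a : ℕ → ℝ`, `C m : ℝ` with `0 < m`, `a ≥ 0`, `a (n+1)^2 ≤ a n * a (n+2)` and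
`a n ≤ C * exp (-(m n))` for all `n`, one has `a (n+1) ≤ exp (-m) * a n` for all `n`. -/
theorem logConvexContraction_proof : LogConvexContraction := by
  unfold LogConvexContraction
  intro a C m _hm hnn hlc hbd n
  by_contra hcon
  rw [not_le] at hcon
  -- hcon : Real.exp (-m) * a n < a (n + 1)
  have hpos1 : 0 < a (n + 1) :=
    lt_of_le_of_lt (mul_nonneg (Real.exp_pos _).le (hnn n)) hcon
  have hpos0 : 0 < a n := by
    rcases (hnn n).lt_or_eq with h | h
    · exact h
    · exfalso
      have h2 := hlc n
      rw [← h, zero_mul] at h2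
      have h3 : a (n + 1) ^ 2 = 0 := le_antisymm h2 (sq_nonneg _)
      exact hpos1.ne' (pow_eq_zero_iff two_ne_zero |>.mp h3)
  obtain ⟨r, hr⟩ : ∃ r : ℝ, r = a (n + 1) / a n := ⟨_, rfl⟩
  have hrpos : 0 < r := by rw [hr]; exact div_pos hpos1 hpos0
  have hr_gt : Real.exp (-m) < r := by
    rw [hr, lt_div_iff₀ hpos0]; exact hcon
  -- positivity and ratio monotonicity propagate along the sequence
  have key : ∀ k, 0 < a (n + k) ∧ r * a (n + k) ≤ a (n + k + 1) := by
    intro k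
    induction k with
    | zero =>
      refine ⟨by simpa using hpos0, ?_⟩
      simp only [Nat.add_zero]
      rw [hr, div_mul_cancel₀ _ hpos0.ne']
    | succ k ih =>
      obtain ⟨hk0, hk1⟩ := ih
      have hk1pos : 0 < a (n + k + 1) := lt_of_lt_of_le (mul_pos hrpos hk0) hk1
      rw [← add_assoc]
      refine ⟨hk1pos, ?_⟩
      have hl := hlc (n + k)
      have h1 : r * a (n + k + 1) * a (n + k) ≤ a (n + k + 1) * a (n + k + 1) := by
        calc r * a (n + k + 1) * a (n + k) = (r * a (n + k)) * a (n + k + 1) := by ring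
          _ ≤ a (n + k + 1) * a (n + k + 1) := mul_le_mul_of_nonneg_right hk1 hk1pos.le
      have h2 : a (n + k + 1) * a (n + k + 1) ≤ a (n + k) * a (n + k + 2) := by
        rw [← sq]; exact hl
      have h3 : r * a (n + k + 1) * a (n + k) ≤ a (n + k + 2) * a (n + k) := by
        calc r * a (n + k + 1) * a (n + k) ≤ a (n + k) * a (n + k + 2) := h1.trans h2
          _ = a (n + k + 2) * a (n + k) := mul_comm _ _
      exact le_of_mul_le_mul_right h3 hk0
  -- geometric lower bound
  have geo : ∀ k, r ^ k * a n ≤ a (n + k) := by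
    intro k
    induction k with
    | zero => simp
    | succ k ih =>
      calc r ^ (k + 1) * a n = r * (r ^ k * a n) := by ring
        _ ≤ r * a (n + k) := mul_le_mul_of_nonneg_left ih hrpos.le
        _ ≤ a (n + k + 1) := (key k).2
        _ = a (n + (k + 1)) := by rw [add_assoc]
  -- the ratio beats the exponential bound
  have hq : 1 < r * Real.exp m := by
    have h1 := mul_lt_mul_of_pos_right hr_gt (Real.exp_pos m)
    rwa [← Real.exp_add, neg_add_cancel, Real.exp_zero] at h1
  obtain ⟨k, hk⟩ := pow_unbounded_of_one_lt (C * Real.exp (-(m * n)) / a n) hq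
  have h1 : r ^ k * a n ≤ C * Real.exp (-(m * ((n : ℝ) + k))) := by
    have h := (geo k).trans (hbd (n + k))
    push_cast at h
    exact h
  have e1 : Real.exp m ^ k = Real.exp ((k : ℝ) * m) := (Real.exp_nat_mul m k).symm
  have e2 : Real.exp (-(m * ((n : ℝ) + k))) * Real.exp ((k : ℝ) * m) = Real.exp (-(m * n)) := by
    rw [← Real.exp_add]; congr 1; ring
  have h2 : (r * Real.exp m) ^ k * a n ≤ C * Real.exp (-(m * n)) := by
    calc (r * Real.exp m) ^ k * a n = r ^ k * a n * Real.exp ((k : ℝ) * m) := by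
            rw [mul_pow, e1]; ring
      _ ≤ C * Real.exp (-(m * ((n : ℝ) + k))) * Real.exp ((k : ℝ) * m) :=
            mul_le_mul_of_nonneg_right h1 (Real.exp_pos _).le
      _ = C * Real.exp (-(m * n)) := by rw [mul_assoc, e2]
  have h3 : (r * Real.exp m) ^ k ≤ C * Real.exp (-(m * n)) / a n := by
    rw [le_div_iff₀ hpos0]; exact h2
  exact absurd hk (not_lt.mpr h3)

end Summit.QuantumFields.YangMills.Theorems
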